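import Summits.BirchSwinnertonDyer.BirchSwinnertonDyer.Theorems.ManinLocalTwoThreeManinPrimeToThreeAtNineOfOrdJLeZero
import HarnessLib

/-!
# At an ODD prime `p`: additive with `|j|_p ≥ 1` and `|j − 1728|_p ≥ 1` ⟹ the twist by any `d` with `p ∥ d` is SEMISTABLE at `p`; hence
# `p ∤ c` on that stratum modulo Mazur + modularity — the prime-generic form of this seat's `p = 3` law, serving C3 (`p = 3`, where
# `|j − 1728|₃ ≥ 1` is automatic) and the residual C5 (`p ≥ 5`) alike (route `ManinLocalTwoThree`, cruxes stmt-BirchSwinnertonDyer-22968 / -22969;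
# cell bsd-f2-manin, p2 gen 15)

Serre–Tate in coordinates, any odd residue characteristic: if the reduction of the potential good model has `j̃ ∉ {0, 1728}` (i.e. `|j|_p = 1 =
|j − 1728|_p`) or the curve is potentially multiplicative (`|j|_p > 1`), the semistability defect is `2`, realised by a quadratic twist ramified at
`p`.  Proof as at `p = 3` (p706475): `C • W = T^{(d)}` with `T = tateFormOfJ j(W)`, `d ∈ ℤ`, `p² ∤ d`
(`exists_int_variableChange_eq_quadraticTwist_tateFormOfJ_not_sq_dvd`); `T` is `p`-integral with unit discriminant when `|j|_p = |j − 1728|_p = 1`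
and is the multiplicative Tate form when `|j|_p > 1`; unit twists keep the reduction type at odd `p` (`hasReductionAt_quadraticTwist_iff_of_not_dvd`),
so additivity forces `p ∥ d`, and for any `d₀` with `p ∥ d₀` the twist `W ⊗ d₀ ≅ T^{(d d₀)} ≅ T^{(d d₀ / p²)}` is a unit twist of `T`.
* `hasGoodReductionAt_or_hasMultiplicativeReductionAt_tateFormOfJ_of_one_le_valuation_j_sub` (any place of `ℤ`);
* `isSemistableAt_quadraticTwist_of_one_le_valuation_j_of_hasAdditiveReductionAt_odd` (odd `p`, any `d₀` with `p ∥ d₀`);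
* `not_dvd_maninConstant_of_one_le_valuation_j_sub_of_mazur`: `p` odd, `p² ∣ N`, lattice-optimal datum of a globally minimal `W` with
  `|j|_p ≥ 1`, `|j − 1728|_p ≥ 1` ⟹ `p ∤ c`, modulo Mazur 1978 Cor. 4.1 and modularity (the tree's `Γ₀` certificate at `p*`).
HONEST FRAMING: local structure + a by-name partial discharge on an explicit `j`-stratum (at `p ≥ 5` the Kodaira rows `I₀*` with `j̃ ∉ {0, 1728}` and
`Iₙ≥1*`, already closed row-wise by `not_dvd_maninConstant_of_kodairaSymbolAt_eq_Istar_of_mazur`; here E-blind in `j`).  Nothing about BSD is proved;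
C3 / C5 / Manin's conjecture OPEN.  No definitions, no named facts, no sorry.
[cite: SilvermanAEC2009, VII.5 Prop. 5.1, Prop. 5.5 and X.5 Cor. 5.4.1] [cite: SilvermanATAEC1994, V.5 Lemma 5.1] [cite: SerreTate1968, §2 Cor. 2]
[cite: Stevens1989, Lemmas (5.2), (5.4)] [cite: Mazur1978, Cor. 4.1]
-/

set_option autoImplicit false
-- lint-debt: the directory name repeats the summit name (sibling precedent `ManinLocalTwoThreeManinPrimeToThreeAtNineOfOrdJLeZero.lean`)
set_option linter.dupNamespace false

noncomputable section

open scoped Classical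
open WeierstrassCurve IsDedekindDomain IsDedekindDomain.HeightOneSpectrum Rat.HeightOneSpectrum
  Literature.NumberTheory.DiophantineGeometry Literature.NumberTheory.EllipticCurves
  Literature.NumberTheory.EllipticCurves.ModularForms

namespace Summit.BirchSwinnertonDyer.BirchSwinnertonDyer.Theorems.ManinLocalTwoThree

section Place

variable (v : HeightOneSpectrum ℤ)

/-- **The Tate form of `j(W)` is SEMISTABLE at any place `v` with `|j|_v ≥ 1` and `|j − 1728|_v ≥ 1`**: good (integral, unit discriminant
`j²/(j − 1728)³`) when `|j|_v = 1`, multiplicative when `|j|_v > 1`. [cite: SilvermanATAEC1994, V.5 Lemma 5.1] [cite: SilvermanAEC2009, VII.5 Prop. 5.1] -/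
theorem hasGoodReductionAt_or_hasMultiplicativeReductionAt_tateFormOfJ_of_one_le_valuation_j_sub (W : WeierstrassCurve ℚ) [W.IsElliptic]
    (hj : 1 ≤ v.valuation ℚ W.j) (hj' : 1 ≤ v.valuation ℚ (W.j - 1728)) :
    (tateFormOfJ W.j).HasGoodReductionAt v ∨ (tateFormOfJ W.j).HasMultiplicativeReductionAt v := by
  rcases hj.eq_or_lt with hj1 | hjlt
  · -- `|j|_v = 1`: then `|j − 1728|_v = 1` and the Tate form is integral with unit discriminant
    left
    have hj1' : v.valuation ℚ W.j = 1 := hj1.symm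
    have h1728 : v.valuation ℚ (1728 : ℚ) ≤ 1 := by simpa using v.valuation_le_one (K := ℚ) (1728 : ℤ)
    have hsub1 : v.valuation ℚ (W.j - 1728) = 1 :=
      le_antisymm ((Valuation.map_sub _ _ _).trans (max_le hj1'.le h1728)) hj'
    have hj0 : W.j ≠ 0 := fun h ↦ by rw [h, map_zero] at hj1'; exact zero_ne_one hj1'
    have hj1728 : W.j ≠ 1728 := fun h ↦ by rw [h, sub_self, map_zero] at hsub1; exact zero_ne_one hsub1
    haveI := isElliptic_tateFormOfJ hj0 hj1728
    have h36 : v.valuation ℚ (36 : ℚ) ≤ 1 := by simpa using v.valuation_le_one (K := ℚ) (36 : ℤ)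
    refine (tateFormOfJ W.j).hasGoodReductionAt_of_valuation_le_one_of_valuation_Δ_eq_one v ?_ ?_ ?_ ?_ ?_ ?_
    · rw [tateFormOfJ_a₁, map_one]
    · rw [tateFormOfJ_a₂, map_zero]; exact zero_le_one
    · rw [tateFormOfJ_a₃, map_zero]; exact zero_le_one
    · rw [tateFormOfJ_a₄, map_div₀, Valuation.map_neg, hsub1, div_one]; exact h36
    · rw [tateFormOfJ_a₆, map_div₀, Valuation.map_neg, map_one, hsub1, div_one]
    · rw [tateFormOfJ_Δ hj1728, map_div₀, map_pow, map_pow, hsub1, hj1', one_pow, one_pow, div_one]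
  · exact Or.inr (W.hasMultiplicativeReductionAt_tateFormOfJ_of_one_lt_valuation_j v hjlt)

/-- **Local law, odd residue characteristic (E-blind).**  At a place `v` of `ℤ` over an odd prime `p`: if the elliptic `W/ℚ` is ADDITIVE at `v`
with `|j(W)|_p ≥ 1` and `|j(W) − 1728|_p ≥ 1`, then for every `d₀ ∈ ℤ` with `p ∥ d₀` the twist `W ⊗ ℚ(√d₀)` is SEMISTABLE at `v` (good or
multiplicative).  [cite: SilvermanAEC2009, VII.5 Prop. 5.1 and X.5 Cor. 5.4.1] [cite: SilvermanATAEC1994, V.5 Lemma 5.1] [cite: SerreTate1968, §2 Cor. 2] -/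
theorem isSemistableAt_quadraticTwist_of_one_le_valuation_j_of_hasAdditiveReductionAt_odd
    (hv2 : natGenerator v ≠ 2) (W : WeierstrassCurve ℚ) [W.IsElliptic]
    (hj : 1 ≤ v.valuation ℚ W.j) (hj' : 1 ≤ v.valuation ℚ (W.j - 1728)) (hadd : W.HasAdditiveReductionAt v)
    {d₀ : ℤ} (hpd₀ : ((natGenerator v : ℕ) : ℤ) ∣ d₀) (hp2d₀ : ¬ ((natGenerator v : ℕ) : ℤ) ^ 2 ∣ d₀) :
    (haveI := W.isElliptic_quadraticTwist (show (d₀ : ℚ) ≠ 0 by exact_mod_cast (show d₀ ≠ 0 by rintro rfl; exact hp2d₀ (dvd_zero _)));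
      (W.quadraticTwist (d₀ : ℚ)).HasGoodReductionAt v ∨ (W.quadraticTwist (d₀ : ℚ)).HasMultiplicativeReductionAt v) := by
  set p : ℕ := natGenerator v with hpdef
  have hp : p.Prime := prime_natGenerator v
  have hd₀0 : d₀ ≠ 0 := by rintro rfl; exact hp2d₀ (dvd_zero _)
  haveI := W.isElliptic_quadraticTwist (show (d₀ : ℚ) ≠ 0 by exact_mod_cast hd₀0)
  -- `j ≠ 0, 1728`
  have hj0 : W.j ≠ 0 := fun h ↦ by
    rw [h, map_zero] at hj; exact not_lt.mpr hj zero_lt_one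
  have hj1728 : W.j ≠ 1728 := fun h ↦ by
    rw [h, sub_self, map_zero] at hj'; exact not_lt.mpr hj' zero_lt_one
  haveI := isElliptic_tateFormOfJ hj0 hj1728
  set T := tateFormOfJ W.j with hT
  have hTsemi := hasGoodReductionAt_or_hasMultiplicativeReductionAt_tateFormOfJ_of_one_le_valuation_j_sub v W hj hj'
  obtain ⟨d, hd0, hdp, C, hC⟩ := exists_int_variableChange_eq_quadraticTwist_tateFormOfJ_not_sq_dvd W hj0 hj1728 hp
  have hd0' : ((d : ℤ) : ℚ) ≠ 0 := by exact_mod_cast hd0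
  haveI := T.isElliptic_quadraticTwist hd0'
  -- `p ∣ d`: otherwise `T^{(d)} ≅ W` would be semistable at `v`
  have hpd : (p : ℤ) ∣ d := by
    by_contra h
    have hCW : (T.quadraticTwist (d : ℚ)).HasAdditiveReductionAt v := by
      rw [← hC]; exact (hasAdditiveReductionAt_smul_iff_holds v W C).mpr hadd
    have hTadd : T.HasAdditiveReductionAt v := (T.hasReductionAt_quadraticTwist_iff_of_not_dvd v hv2 (d := d) h).2.2.mp hCW
    rcases hTsemi with hg | hm
    · exact hTadd.not_hasGoodReductionAt hg
    · exact hTadd.not_hasMultiplicativeReductionAt hm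
  obtain ⟨e, he⟩ := hpd
  obtain ⟨e₀, he₀⟩ := hpd₀
  have hpe : ¬ (p : ℤ) ∣ e := by
    rintro ⟨f, hf⟩; exact hdp ⟨f, by rw [he, hf]; ring⟩
  have hpe₀ : ¬ (p : ℤ) ∣ e₀ := by
    rintro ⟨f, hf⟩; exact hp2d₀ ⟨f, by rw [he₀, hf]; ring⟩
  have hpee₀ : ¬ ((natGenerator v : ℕ) : ℤ) ∣ e * e₀ := by
    rw [← hpdef]
    intro h
    rcases (Int.Prime.dvd_mul' hp h) with h1 | h2
    · exact hpe h1
    · exact hpe₀ h2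
  have hee₀0 : e * e₀ ≠ 0 := by
    intro h; rcases mul_eq_zero.mp h with h | h
    · exact hd0 (by rw [he, h, mul_zero])
    · exact hd₀0 (by rw [he₀, h, mul_zero])
  have hee₀0' : ((e * e₀ : ℤ) : ℚ) ≠ 0 := by exact_mod_cast hee₀0
  haveI := T.isElliptic_quadraticTwist hee₀0'
  -- `C₁ • (W ⊗ d₀) = (C • W) ⊗ d₀ = T^{(d d₀)} = T^{((e e₀) p²)} = C₂ • T^{(e e₀)}`
  have hp0 : ((p : ℤ) : ℚ) ≠ 0 := by exact_mod_cast (show (p : ℤ) ≠ 0 by exact_mod_cast hp.ne_zero)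
  obtain ⟨C₂, hC₂⟩ := T.exists_variableChange_quadraticTwist_mul_sq ((e * e₀ : ℤ) : ℚ) ((p : ℤ) : ℚ) hp0
  have harg : ((d : ℤ) : ℚ) * ((d₀ : ℤ) : ℚ) = ((e * e₀ : ℤ) : ℚ) * ((p : ℤ) : ℚ) ^ 2 := by
    have h : d * d₀ = (e * e₀) * (p : ℤ) ^ 2 := by rw [he, he₀]; ring
    exact_mod_cast h
  have hkey : (⟨C.u, ((d₀ : ℤ) : ℚ) * C.r, 0, 0⟩ : VariableChange ℚ) • W.quadraticTwist (d₀ : ℚ) = C₂ • T.quadraticTwist ((e * e₀ : ℤ) : ℚ) := by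
    rw [← WeierstrassCurve.quadraticTwist_smul, hC, quadraticTwist_quadraticTwist, hC₂, harg]
  have hunit := T.hasReductionAt_quadraticTwist_iff_of_not_dvd v hv2 (d := e * e₀) hpee₀
  rcases hTsemi with hg | hm
  · left
    have h1 : (C₂ • T.quadraticTwist ((e * e₀ : ℤ) : ℚ)).HasGoodReductionAt v :=
      (hasGoodReductionAt_smul_iff_holds v _ C₂).mpr (hunit.1.mpr hg)
    rw [← hkey] at h1
    exact (hasGoodReductionAt_smul_iff_holds v _ _).mp h1
  · right
    have h1 : (C₂ • T.quadraticTwist ((e * e₀ : ℤ) : ℚ)).HasMultiplicativeReductionAt v :=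
      (hasMultiplicativeReductionAt_smul_iff_holds v _ C₂).mpr (hunit.2.1.mpr hm)
    rw [← hkey] at h1
    exact (hasMultiplicativeReductionAt_smul_iff_holds v _ _).mp h1

end Place

/-- **`p ∤ c` on the stratum `|j|_p ≥ 1`, `|j − 1728|_p ≥ 1`, for every ODD prime `p` with `p² ∣ N`** (lattice-optimal `X₀(N)`-datum of a
globally minimal `W`), modulo Mazur 1978 Cor. 4.1 (`hM`) and modularity (`hnf`): the twist by `p*` (`p ∥ p*`) is semistable at `p`, and the tree's
`Γ₀` certificate `not_dvd_maninConstant_of_isSemistableAt_quadraticTwist_pStar_of_mazur` concludes.  At `p = 3` this is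
`not_three_dvd_maninConstant_of_one_le_valuation_j_of_mazur` (the second hypothesis is automatic); at `p ≥ 5` it serves the residual C5.
[cite: Stevens1989, Lemmas (5.2), (5.4)] [cite: Mazur1978, Cor. 4.1] [cite: SilvermanAEC2009, X.5 Cor. 5.4.1] -/
theorem not_dvd_maninConstant_of_one_le_valuation_j_sub_of_mazur
    (hM : mazur_not_dvd_maninConstant_of_odd) (hnf : exists_isNewformOf) {p : ℕ} (hp : p.Prime) (hp2 : p ≠ 2)
    {W : WeierstrassCurve ℚ} [W.IsElliptic] [W.IsGloballyMinimal] {N : ℕ} [NeZero N] (D : ModularParametrizationData W N)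
    (hopt : ∀ z ∈ D.L.lattice, ∃ w ∈ periodLattice D.f, z = D.c * w) (hpN : p ^ 2 ∣ N)
    (hj : 1 ≤ ((primesEquiv (R := ℤ)).symm ⟨p, hp⟩).valuation ℚ W.j)
    (hj' : 1 ≤ ((primesEquiv (R := ℤ)).symm ⟨p, hp⟩).valuation ℚ (W.j - 1728)) :
    ¬ (p : ℤ) ∣ D.maninConstant := by
  haveI : Fact p.Prime := ⟨hp⟩
  set v : HeightOneSpectrum ℤ := (primesEquiv (R := ℤ)).symm ⟨p, hp⟩ with hvdef
  have hv : natGenerator v = p := congrArg Subtype.val ((primesEquiv (R := ℤ)).apply_symm_apply ⟨p, hp⟩)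
  haveI : PerfectField (IsLocalRing.ResidueField (v.adicCompletionIntegers ℚ)) := PerfectField.ofFinite
  -- `W` is additive at `p`
  have hN : N = W.conductorNorm ℤ := IsNewformOf.level_eq_conductorNorm_of_exists_isNewformOf hnf D.isNewformOf
  have hadd : W.HasAdditiveReductionAt v := by
    have hfac : (W.conductorNorm ℤ).factorization p = W.conductorExponent v := factorization_conductorNorm_primesEquiv_symm W ⟨p, hp⟩
    refine (two_le_conductorExponent_iff_holds v W).mp ?_
    rw [← hfac]
    exact (hp.pow_dvd_iff_le_factorization (W.conductorNorm_pos_holds).ne').mp (hN ▸ hpN)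
  -- `p ∥ p*`
  set d₀ : ℤ := (-1 : ℤ) ^ (p / 2) * p with hd₀
  have hpd₀ : ((natGenerator v : ℕ) : ℤ) ∣ d₀ := by rw [hv, hd₀]; exact dvd_mul_left _ _
  have hp2d₀ : ¬ ((natGenerator v : ℕ) : ℤ) ^ 2 ∣ d₀ := by
    rw [hv]
    intro h
    have habs : d₀.natAbs = p := by
      rw [hd₀, Int.natAbs_mul, Int.natAbs_pow, Int.natAbs_neg, Int.natAbs_one, one_pow, one_mul, Int.natAbs_natCast]
    have hdvd : p ^ 2 ∣ p := by
      have h' := Int.natAbs_dvd_natAbs.mpr h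
      rwa [Int.natAbs_pow, Int.natAbs_natCast, habs] at h'
    have hle : p ^ 2 ≤ p := Nat.le_of_dvd hp.pos hdvd
    nlinarith [hp.one_lt]
  have hsemi := isSemistableAt_quadraticTwist_of_one_le_valuation_j_of_hasAdditiveReductionAt_odd v (by rw [hv]; exact hp2) W hj hj' hadd
    hpd₀ hp2d₀
  exact not_dvd_maninConstant_of_isSemistableAt_quadraticTwist_pStar_of_mazur hM hnf D hopt hp hp2 hpN hsemi

end Summit.BirchSwinnertonDyer.BirchSwinnertonDyer.Theorems.ManinLocalTwoThree

end
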